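import Summits.QuantumFields.YangMills.Theorems.BalabanLadderIRTwistedSpectralDatum
import Literature.MathematicalPhysics.QuantumFieldTheory.WilsonFinTorusTwistedPartition
import Summits.QuantumFields.YangMills.Theorems.BalabanLadderIRAbstractBasinRung

/-!
# Purity forces a flux-free top state and cheap central temporal twists — `δᶜ ≥ (1 − Z^{(z)}/Z)/2` and `E(θ) ⇒ F_exit(2θ)`

HELPER for the crux `BalabanLadder.IR` (stmt-QuantumFields-19354; ideator ym-ir-idea-9 g3, lens «transfer»; `--supports` the crux,
`--as helper`; part 2 of 2, part 1 = `BalabanLadderIRTwistedSpectralDatum`: the abstract [TTF]∕[TTF-ℝ] theorems and the kernel-level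
composition `twist_cost_le_of_pure_kernel`).  This is the Theorems-lane composition the cell asked for (critic ym-ir-crit-3,
2026-08-28 06:43Z; literature typer ym-ir-lit-4 g2, p611125 + p611637): part 1 COMPOSED with the Wilson-side identities now in
`Literature.MathematicalPhysics.QuantumFieldTheory.WilsonFinTorusTwistedPartition` (p611125: the slice twist `finSliceTwist`,
Haar-preserving and leaving the slice kernel invariant for central twists; the twisted time-slicing identity in iterate form
`wilsonFinTorusTwistedPartition_eq_integral_iterate`; the exposed eigenbasis `exists_eigenbasis_finTorusSliceKernel`).

HONEST FRAMING.  Transfer-matrix bookkeeping.  Nothing here proves the Yang–Mills mass gap (Clay), a lattice gap, the crux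
`BalabanLadder.IR`, its seed `E = BasinRung.ColdExitAt θ`, idea-10's `F = ConfinedTemporalTwistSC` at all large scales, or idea-10's
`HeavyTwistSU2`; `R4` closes only the conditional finite-𝕋⁴ rung `BalabanLadder.UV`.  The arrows proved go OUT of the seed.

RESULTS (every compact `G`, continuous unitary `ρ`, `β ≥ 0`, every spatial box `b₁ × b₂ × b₃`, every central temporal twist
`z : Fin 4 → G`, `Z^{(z)} = wilsonFinTorusTwistedPartition ρ β z`, `Z = wilsonFinTorusPartition ρ β`):
* `twistedPartition_le` — a central twist never raises the partition function: `Z^{(z)}(b, m+2) ≤ Z(b, m+2)`;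
* `twist_cost_le_of_purity` — PURITY ⇒ CHEAP TWISTS at both times of the defect:
  `1 − Z(b, 2(m+2))/Z(b, m+2)² ≤ θ ⇒ 1 − Z^{(z)}(b, m+2)/Z(b, m+2) ≤ 2θ ∧ 1 − Z^{(z)}(b, 2(m+2))/Z(b, 2(m+2)) ≤ 2θ`;
* `half_twist_cost_le_coldDefect` — the S1 shape of the line `heavy-twist` (idea-10) for EVERY compact `G` and every central `z`:
  `(1 − Z^{(z)}(L³×t)/Z(L³×t))/2 ≤ coldDefect ρ β L` at `t = ⌊L/4⌋` and `t = 2⌊L/4⌋`, `L ≥ 8`;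
* `FluxExitAt θ` and `fluxExitAt_of_coldExitAt : BasinRung.ColdExitAt θ → FluxExitAt (2 * θ)` — the seed forces every central temporal
  twist of its cold boxes to cost at most the fraction `2θ` (`|Z^{(z)} − Z| ≤ 2θ·Z`), i.e. 't Hooft's «heavy electric flux» at the exit scale.
Reading for census row 21 (`flux-purity-split`, idea-10: `F ∧ V ⇒ E`, `E ⇒ V`): the split exceeds the seed exactly by the scale-quantifier
upgrade exit-scale → all large scales on the flux half.

MECHANISM (part 1, model-free; the kernel lemmas named are lit-4's p611637).  [TTF]: twisted thermal traces `z c τ = Σᵢ χᵢ(c) λᵢ^τ` with joint eigen-data and unit flux characters;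
purity `≥ 1 − θ` puts weight `≥ 1 − θ` on the top state (`Σ pᵢ² ≤ max pᵢ`); at the kernel level Perron–Frobenius (Jentzsch, positivity
improving transfer operator, simple top eigenvalue with a positive eigenvector) makes the top state twist-invariant with NO purity input
(`integral_twisted_coeff_top`: the finite-volume ground state carries no electric flux), and Cauchy–Schwarz with measure preservation bounds
every other twisted coefficient by `λᵢ²` (`abs_integral_twisted_coeff_le`); the twisted trace formula `hasSum_pow_integral_iterate_twisted`
needs no invariance at all.  Sources: 't Hooft 1979 (NPB 153) §§2, 4, 5; Lüscher 1977; Montvay–Münster (3.145); Greensite 2011 §4.4.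
-/

set_option autoImplicit false

noncomputable section

namespace Summit.QuantumFields.YangMills.Cruxes.IR.TwistCost

/-! ## Wilson's theory: the discharge over `Literature.MathematicalPhysics.QuantumFieldTheory.WilsonFinTorusTwistedPartition`

The hypotheses `hT`, `hKT`, `hz` of `twist_cost_le_of_pure_kernel` for Wilson's action with a continuous unitary `ρ`, `β ≥ 0`, on
ANY spatial box `b₁ × b₂ × b₃`: the twist family is indexed by `c : Fin 4 → Z(G)` (pointwise group, `1` = no twist), the twist map
is lit-4's slice twist `finSliceTwist c` (Haar-preserving: `measurePreserving_finSliceTwist`; slice-kernel invariant for central `c`: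
`finTorusSliceKernel_finSliceTwist`), the twisted traces are `Z^{(c)} = wilsonFinTorusTwistedPartition ρ β c`, and `hz` IS the
twisted time-slicing identity `wilsonFinTorusTwistedPartition_eq_integral_iterate`; the eigen-data are
`exists_eigenbasis_finTorusSliceKernel`.  Everything in this section holds for EVERY compact group `G` (abelian, finite, simple or
not) — it is bookkeeping, not Yang–Mills content. -/

section Wilson

open MeasureTheory Function Filter
open scoped ENNReal
open Literature.Analysis.OperatorTheory Literature.MathematicalPhysics.QuantumFieldTheory

variable {G : Type} [Group G] [TopologicalSpace G] [IsTopologicalGroup G] [CompactSpace G]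
  [MeasurableSpace G] [BorelSpace G] {N : ℕ}

/-- The centre-twisted Wilson partition functions of the box `b₁ × b₂ × b₃ × n` as a family indexed by `c : Fin 4 → Z(G)`
(`c = 1` ↦ `Z`), the index type carrying the pointwise group structure the abstract theorem wants. -/
def centreTwistedZ (ρ : G →* Matrix (Fin N) (Fin N) ℂ) (β : ℝ) (b₁ b₂ b₃ : ℕ) (c : Fin 4 → Subgroup.center G)
    (n : ℕ) : ℝ :=
  wilsonFinTorusTwistedPartition ρ β (fun μ => (c μ : G)) b₁ b₂ b₃ n

omit [TopologicalSpace G] [IsTopologicalGroup G] [CompactSpace G] [MeasurableSpace G]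
  [BorelSpace G] in
/-- The coercion of the trivial centre family is the trivial twist. -/
theorem coe_centre_one : (fun μ : Fin 4 => (((1 : Fin 4 → Subgroup.center G) μ : Subgroup.center G) : G)) = 1 := by
  funext μ
  simp

/-- `c = 1` is Wilson's partition function. -/
theorem centreTwistedZ_one (ρ : G →* Matrix (Fin N) (Fin N) ℂ) (β : ℝ) (b₁ b₂ b₃ n : ℕ) :
    centreTwistedZ ρ β b₁ b₂ b₃ 1 n = wilsonFinTorusPartition ρ β b₁ b₂ b₃ n := by
  unfold centreTwistedZ
  rw [coe_centre_one, wilsonFinTorusTwistedPartition_one]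

/-- The family member at a central `z : Fin 4 → G` is `Z^{(z)}`. -/
theorem centreTwistedZ_mk (ρ : G →* Matrix (Fin N) (Fin N) ℂ) (β : ℝ) (b₁ b₂ b₃ n : ℕ) {z : Fin 4 → G}
    (hz : ∀ μ, z μ ∈ Subgroup.center G) :
    centreTwistedZ ρ β b₁ b₂ b₃ (fun μ => ⟨z μ, hz μ⟩) n = wilsonFinTorusTwistedPartition ρ β z b₁ b₂ b₃ n := rfl

/-- **A central temporal twist never raises the partition function**: `Z^{(z)}(b, m+2) ≤ Z(b, m+2)` (`β ≥ 0`, continuous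
unitary `ρ`; `|κᵢ(z)| ≤ 1` termwise in the twisted trace formula). ['t Hooft 1979 (2.20): `Σ_e w_e χ_e(z) ≤ Σ_e w_e`] -/
theorem twistedPartition_le [SecondCountableTopology G] {ρ : G →* Matrix (Fin N) (Fin N) ℂ} (hρ : Continuous ρ)
    (hρu : ∀ g, ρ g ∈ Matrix.unitaryGroup (Fin N) ℂ) {β : ℝ} (hβ : 0 ≤ β) (b₁ b₂ b₃ m : ℕ) {z : Fin 4 → G}
    (hz : ∀ μ, z μ ∈ Subgroup.center G) :
    wilsonFinTorusTwistedPartition ρ β z b₁ b₂ b₃ (m + 2) ≤ wilsonFinTorusPartition ρ β b₁ b₂ b₃ (m + 2) := by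
  haveI : IsFiniteMeasure (haarProbability G) := by
    dsimp [haarProbability]; infer_instance
  obtain ⟨C, A, s, hcnt, b, lam, i₀, hC, hA, hb, hlam, -, -⟩ := exists_eigenbasis_finTorusSliceKernel hρ hρu hβ b₁ b₂ b₃
  haveI : Countable s := hcnt
  have hK := stronglyMeasurable_uncurry_finTorusSliceKernel (b₁ := b₁) (b₂ := b₂) (b₃ := b₃) ρ hρ β
  have hsymm : ∀ x y : FinSpatialSite b₁ b₂ b₃ × Fin 3 → G,
      finTorusSliceKernel ρ β x y = finTorusSliceKernel ρ β y x := finTorusSliceKernel_symm ρ hρu β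
  have hz' : ∀ i : Fin 3, z i.castSucc ∈ Subgroup.center G := fun i => hz _
  have h1 : ∀ i : Fin 3, (1 : Fin 4 → G) i.castSucc ∈ Subgroup.center G := fun i => Subgroup.one_mem _
  have h := integral_iterate_twisted_le hK hC hsymm hA hb (fun i => (hlam i).1) (measurePreserving_finSliceTwist z) m
  rw [wilsonFinTorusTwistedPartition_eq_integral_iterate ρ hρ β hz' b₁ b₂ b₃ m, ← wilsonFinTorusTwistedPartition_one,
    wilsonFinTorusTwistedPartition_eq_integral_iterate ρ hρ β h1 b₁ b₂ b₃ m]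
  simpa only [finSliceTwist_one, id_eq] using h

/-- **PURITY ⇒ EVERY CENTRAL TEMPORAL TWIST IS CHEAP, at both times of the defect** (every compact `G`, continuous unitary `ρ`,
`β ≥ 0`, every box, every `m`): `1 − Z(2(m+2))/Z(m+2)² ≤ θ ⇒ 1 − Z^{(z)}(m+2)/Z(m+2) ≤ 2θ ∧ 1 − Z^{(z)}(2(m+2))/Z(2(m+2)) ≤ 2θ`.
The kernel-level theorem `twist_cost_le_of_pure_kernel` with lit-4's Wilson-side identities as its hypotheses. -/
theorem twist_cost_le_of_purity [SecondCountableTopology G] {ρ : G →* Matrix (Fin N) (Fin N) ℂ} (hρ : Continuous ρ)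
    (hρu : ∀ g, ρ g ∈ Matrix.unitaryGroup (Fin N) ℂ) {β : ℝ} (hβ : 0 ≤ β) (b₁ b₂ b₃ m : ℕ) {θ : ℝ}
    (hpure : 1 - wilsonFinTorusPartition ρ β b₁ b₂ b₃ (2 * (m + 2)) / wilsonFinTorusPartition ρ β b₁ b₂ b₃ (m + 2) ^ 2 ≤ θ)
    {z : Fin 4 → G} (hz : ∀ μ, z μ ∈ Subgroup.center G) :
    1 - wilsonFinTorusTwistedPartition ρ β z b₁ b₂ b₃ (m + 2) / wilsonFinTorusPartition ρ β b₁ b₂ b₃ (m + 2) ≤ 2 * θ ∧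
    1 - wilsonFinTorusTwistedPartition ρ β z b₁ b₂ b₃ (2 * (m + 2)) /
      wilsonFinTorusPartition ρ β b₁ b₂ b₃ (2 * (m + 2)) ≤ 2 * θ := by
  haveI : IsFiniteMeasure (haarProbability G) := by
    dsimp [haarProbability]; infer_instance
  obtain ⟨C, A, s, hcnt, b, lam, i₀, hC, hA, hb, hlam, hi₀, hL0⟩ :=
    exists_eigenbasis_finTorusSliceKernel hρ hρu hβ b₁ b₂ b₃
  haveI : Countable s := hcnt
  have hK := stronglyMeasurable_uncurry_finTorusSliceKernel (b₁ := b₁) (b₂ := b₂) (b₃ := b₃) ρ hρ β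
  have hsymm : ∀ x y : FinSpatialSite b₁ b₂ b₃ × Fin 3 → G,
      finTorusSliceKernel ρ β x y = finTorusSliceKernel ρ β y x := finTorusSliceKernel_symm ρ hρu β
  have hKpos : ∀ x y : FinSpatialSite b₁ b₂ b₃ × Fin 3 → G, 0 < finTorusSliceKernel ρ β x y :=
    finTorusSliceKernel_pos ρ hρ β
  have hc : ∀ (c : Fin 4 → Subgroup.center G) (i : Fin 3), (fun μ => (c μ : G)) i.castSucc ∈ Subgroup.center G :=
    fun c i => (c i.castSucc).2
  have hT1 : (finSliceTwist (fun μ : Fin 4 => (((1 : Fin 4 → Subgroup.center G) μ : Subgroup.center G) : G)) :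
      (FinSpatialSite b₁ b₂ b₃ × Fin 3 → G) → _) = id := by
    rw [coe_centre_one]
    exact finSliceTwist_one
  have key := twist_cost_le_of_pure_kernel (Tw := Fin 4 → Subgroup.center G)
    (μ := Measure.pi fun _ : FinSpatialSite b₁ b₂ b₃ × Fin 3 => haarProbability G)
    (K := finTorusSliceKernel ρ β) hK hC hsymm hKpos hA hb (fun i => (hlam i).1) hi₀ hL0
    (fun c => finSliceTwist (fun μ => (c μ : G))) hT1 (fun c => measurePreserving_finSliceTwist _)
    (fun c x y => finTorusSliceKernel_finSliceTwist ρ (hc c) β x y) (z := centreTwistedZ ρ β b₁ b₂ b₃)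
    (fun c m' => wilsonFinTorusTwistedPartition_eq_integral_iterate ρ hρ β (hc c) b₁ b₂ b₃ m') (θ := θ) m
    (by rw [centreTwistedZ_one, centreTwistedZ_one]; exact hpure) (fun μ => ⟨z μ, hz μ⟩)
  rwa [centreTwistedZ_one, centreTwistedZ_one, centreTwistedZ_mk, centreTwistedZ_mk] at key

/-- **`δᶜ ≥ (1 − Z^{(z)}/Z)/2` — the S1 shape of the line `heavy-twist`, for EVERY compact `G` and every central temporal twist**:
at `β ≥ 0`, `L ≥ 8`, the period-doubling purity defect `coldDefect ρ β L` of the cold box `L³ × ⌊L/4⌋` dominates half the cost of any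
central temporal twist of the boxes `L³ × ⌊L/4⌋` and `L³ × 2⌊L/4⌋`.  (idea-10's `PurityTwistBoundAt r c μ` for central `c` is the first
conjunct with `z = Function.update 1 μ c`, up to its verbatim copy `twistedColdZ` of `wilsonFinTorusTwistedPartition`.) -/
theorem half_twist_cost_le_coldDefect [SecondCountableTopology G] {ρ : G →* Matrix (Fin N) (Fin N) ℂ} (hρ : Continuous ρ)
    (hρu : ∀ g, ρ g ∈ Matrix.unitaryGroup (Fin N) ℂ) {β : ℝ} (hβ : 0 ≤ β) {L : ℕ} (hL : 8 ≤ L) {z : Fin 4 → G}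
    (hz : ∀ μ, z μ ∈ Subgroup.center G) :
    (1 - wilsonFinTorusTwistedPartition ρ β z L L L (L / 4) / wilsonFinTorusPartition ρ β L L L (L / 4)) / 2 ≤
        ColdPurityBridge.coldDefect ρ β L ∧
      (1 - wilsonFinTorusTwistedPartition ρ β z L L L (2 * (L / 4)) / wilsonFinTorusPartition ρ β L L L (2 * (L / 4))) / 2 ≤
        ColdPurityBridge.coldDefect ρ β L := by
  obtain ⟨m, hm⟩ : ∃ m : ℕ, L / 4 = m + 2 := ⟨L / 4 - 2, by omega⟩
  have hpure : 1 - wilsonFinTorusPartition ρ β L L L (2 * (m + 2)) / wilsonFinTorusPartition ρ β L L L (m + 2) ^ 2 ≤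
      ColdPurityBridge.coldDefect ρ β L := by
    unfold ColdPurityBridge.coldDefect
    rw [hm]
  have key := twist_cost_le_of_purity hρ hρu hβ L L L m hpure hz
  rw [hm]
  constructor <;> linarith [key.1, key.2]

/-- **`F_exit(θ)` — 't Hooft's heavy-electric-flux statement at the EXIT scale**: same binders as `BasinRung.ColdExitAt`; for every
simply connected compact simple `G` and every lattice representation `r`, at all large `β`, at SOME lattice size `L ≥ 8`, EVERY
central temporal twist `z` changes the partition function of `L³ × t`, `t ∈ {⌊L/4⌋, 2⌊L/4⌋}`, by at most the fraction `θ`.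
(idea-10's `ConfinedTemporalTwistSC` of `Cruxes/IR/Lines/flux_purity_split.lean` with its quantifier block `∀ ε > 0 ∃ β₁ ∀ β ≥ β₁ ∃ L₁
∀ L ≥ L₁` replaced by `θ` fixed, `∃ L ≥ 8`, stated over `wilsonFinTorusTwistedPartition`.) -/
def FluxExitAt (θ : ℝ) : Prop :=
  ∀ (G : Type) [Group G] [TopologicalSpace G] [IsTopologicalGroup G] [CompactSpace G],
    IsCompactSimpleLieGroup G → SimplyConnectedSpace G →
    letI : MeasurableSpace G := borel G; haveI : BorelSpace G := ⟨rfl⟩;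
    ∀ r : LatticeRep G, ∃ β₁ : ℝ, ∀ β : ℝ, β₁ ≤ β → ∃ L : ℕ, 8 ≤ L ∧
      ∀ z : Fin 4 → G, (∀ μ, z μ ∈ Subgroup.center G) → ∀ t : ℕ, (t = L / 4 ∨ t = 2 * (L / 4)) →
        |wilsonFinTorusTwistedPartition r.ρ β z L L L t - wilsonFinTorusPartition r.ρ β L L L t| ≤
          θ * wilsonFinTorusPartition r.ρ β L L L t

/-- **THE ARROW `E(θ) ⇒ F_exit(2θ)`.**  The seed `ColdExitAt θ` of the crux `BalabanLadder.IR` forces, at its own exit scale,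
«every electric-flux sector of the cold box is as heavy as the vacuum sector up to `2θ`»: `|Z^{(z)}(L³×t) − Z(L³×t)| ≤ 2θ·Z(L³×t)`,
`t ∈ {⌊L/4⌋, 2⌊L/4⌋}`, every central `z`.  An arrow OUT of the seed (no Yang–Mills content). -/
theorem fluxExitAt_of_coldExitAt {θ : ℝ} (hE : BasinRung.ColdExitAt θ) : FluxExitAt (2 * θ) := by
  intro G _ _ _ _ hG hsc
  letI : MeasurableSpace G := borel G
  haveI : BorelSpace G := ⟨rfl⟩
  intro r
  haveI : SecondCountableTopology G :=
    (r.continuous.isClosedEmbedding r.injective).isEmbedding.secondCountableTopology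
  obtain ⟨β₁, hβ₁⟩ := hE G hG hsc r
  refine ⟨max β₁ 0, fun β hβ => ?_⟩
  obtain ⟨L, hL, hδ⟩ := hβ₁ β ((le_max_left _ _).trans hβ)
  have hβ0 : 0 ≤ β := (le_max_right _ _).trans hβ
  refine ⟨L, hL, fun z hz t ht => ?_⟩
  obtain ⟨m, hm⟩ : ∃ m : ℕ, L / 4 = m + 2 := ⟨L / 4 - 2, by omega⟩
  have hδ' : 1 - wilsonFinTorusPartition r.ρ β L L L (2 * (m + 2)) /
      wilsonFinTorusPartition r.ρ β L L L (m + 2) ^ 2 ≤ θ := by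
    have h := hδ
    unfold ColdPurityBridge.coldDefect at h
    rwa [hm] at h
  have key := twist_cost_le_of_purity r.continuous r.mem_unitary hβ0 L L L m hδ' hz
  -- the generic step: `Z^{tw} ≤ Z`, `1 − Z^{tw}/Z ≤ 2θ`, `Z > 0` ⇒ `|Z^{tw} − Z| ≤ 2θ Z`
  have step : ∀ n : ℕ, 1 - wilsonFinTorusTwistedPartition r.ρ β z L L L (n + 2) /
        wilsonFinTorusPartition r.ρ β L L L (n + 2) ≤ 2 * θ →
      |wilsonFinTorusTwistedPartition r.ρ β z L L L (n + 2) - wilsonFinTorusPartition r.ρ β L L L (n + 2)| ≤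
        2 * θ * wilsonFinTorusPartition r.ρ β L L L (n + 2) := by
    intro n hlow
    have hW : 0 < wilsonFinTorusPartition r.ρ β L L L (n + 2) := wilsonFinTorusPartition_pos r.continuous β L L L _
    have hup := twistedPartition_le r.continuous r.mem_unitary hβ0 L L L n hz
    rw [abs_sub_comm, abs_of_nonneg (sub_nonneg.2 hup)]
    rw [one_sub_div hW.ne', div_le_iff₀ hW] at hlow
    exact hlow
  rcases ht with rfl | rfl
  · rw [hm]
    exact step m key.1
  · rw [hm, show 2 * (m + 2) = 2 * m + 2 + 2 by ring]
    refine step (2 * m + 2) ?_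
    rw [show 2 * m + 2 + 2 = 2 * (m + 2) by ring]
    exact key.2

end Wilson

end Summit.QuantumFields.YangMills.Cruxes.IR.TwistCost

end
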